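import Summits.CriticalPhenomena.CardyFormulaZ2.Theorems.CardyWhiteToColouredSimilarityUpgradeStubSymmetricHalf
import Summits.CriticalPhenomena.CardyFormulaZ2.Theorems.CardyTensorRGPolyominoGaussianLawSquareLimitPart4

/-!
# The crux's law on the lattice-symmetric class, for every exponent
# (crux `PolyominoGaussianLaw`, stmt-CriticalPhenomena-14337, route `CardyTensorRG`, line `registered`,
# skeleton v8: auxiliary stub `stub_symmetricClassBetaLaw`)

Let `R = (Ω; a, b, c, d)` be a conformal rectangle and `σ z = u z̄`, `u ∈ {1, -1, i, -i}`, one of the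
four anti-linear lattice symmetries of `ℤ²`. If `σ(Ω) = Ω`, `σ` exchanges the two pairs of opposite
arcs of `R`, fixes `a` and `c` and maps `b ↦ d`, then for EVERY exponent `a < 1` the bond-`ℤ²`
crossing probability of `R` tends, as the mesh `δ → 0⁺`, to the normalised incomplete beta law
`I_a(η) = ∫₀^η (s(1-s))^{-a} ds / ∫₀¹ (s(1-s))^{-a} ds` evaluated at the cross-ratio `η` of any
uniformizing datum — both sides being `1/2`:

* `bondDomainCrossingProb R δ → 1/2` is the tree's `SimilarityUpgrade.Stubs.stub_symmetricHalf`
  (limit self-duality `stub_dualSum` + exact lattice symmetry of the crossing probability);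
* `η = 1/2` is the symmetry principle `ConformalRectangle.crossRatio_eq_half_of_antiAffine`
  (a conformal rectangle with an anti-conformal symmetry fixing `a, c` and exchanging `b, d` is
  conformally a square);
* `I_a(1/2) = 1/2` is `sq_betaLaw_half` (symmetry `s ↦ 1 - s` of the kernel).

This is the template `SimilarityUpgrade.Stubs.cardy_of_symmetricHalf` with Cardy's function replaced by
`I_a`; it records that both open cores of the line (`stub_dyadicLimitExists`,
`stub_dyadicLimitIsBetaLaw`) hold on the lattice-symmetric class, for every exponent.

References: S. Smirnov, *Critical percolation in the plane*, C. R. Acad. Sci. Paris 333 (2001), §2;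
V. Beffara, *Cardy's formula on the triangular lattice, the easy way* (2007), proof of Prop. 4;
L. V. Ahlfors, *Complex Analysis* (1979), Ch. 4 §6.5.
-/

noncomputable section

namespace Summit.CriticalPhenomena.CardyFormulaZ2.Cruxes.PolyominoGaussianLaw.Birth

open Filter Topology Set MeasureTheory
open Literature.Probability.RandomPlanarGeometry
open Literature.Probability.Percolation (bondDomainCrossingProb)
open Summit.CriticalPhenomena.CardyFormulaZ2.Cruxes.SimilarityUpgrade.Stubs (stub_symmetricHalf)

/-- aux stub 7 (v8). **The crux's law holds, for EVERY exponent `a < 1`, on every lattice-symmetric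
conformal rectangle**: if `σ z = u z̄` (`u ∈ {1, -1, i, -i}`) preserves the carrier of `R = (Ω; a, b, c, d)`,
exchanges the two pairs of opposite arcs, fixes `a`, `c` and maps `b ↦ d`, then
`bondDomainCrossingProb R δ → I_a(crossRatio x) = I_a(1/2) = 1/2` for every uniformizing datum
(`stub_symmetricHalf`, `crossRatio_eq_half_of_antiAffine`, `sq_betaLaw_half`). [folklore] -/
theorem stub_symmetricClassBetaLaw :
    ∀ (R : Literature.Probability.RandomPlanarGeometry.ConformalRectangle) (u : ℂ),
      (u = 1 ∨ u = -1 ∨ u = Complex.I ∨ u = -Complex.I) →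
      (fun z : ℂ => u * (starRingEnd ℂ) z) '' R.carrier = R.carrier →
      ((fun z : ℂ => u * (starRingEnd ℂ) z) '' R.arc 0 = R.arc 1 ∧
          (fun z : ℂ => u * (starRingEnd ℂ) z) '' R.arc 2 = R.arc 3 ∨
        (fun z : ℂ => u * (starRingEnd ℂ) z) '' R.arc 0 = R.arc 3 ∧
          (fun z : ℂ => u * (starRingEnd ℂ) z) '' R.arc 2 = R.arc 1) →
      u * (starRingEnd ℂ) (R.pt 0) = R.pt 0 → u * (starRingEnd ℂ) (R.pt 2) = R.pt 2 →
      u * (starRingEnd ℂ) (R.pt 1) = R.pt 3 →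
      ∀ a : ℝ, a < 1 →
        R.HasCrossingLimit (Literature.Probability.Percolation.bondDomainCrossingProb R)
          (fun η : ℝ => intervalIntegral (fun s : ℝ => (s * (1 - s)) ^ (-a)) 0 η MeasureTheory.volume /
            intervalIntegral (fun s : ℝ => (s * (1 - s)) ^ (-a)) 0 1 MeasureTheory.volume) := by
  intro R u hu hΩ harcs h0 h2 h1 a ha φ x hφx
  show Tendsto (bondDomainCrossingProb R) (𝓝[>] 0)
    (𝓝 (intervalIntegral (fun s : ℝ => (s * (1 - s)) ^ (-a)) 0 (crossRatio x) volume /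
      intervalIntegral (fun s : ℝ => (s * (1 - s)) ^ (-a)) 0 1 volume))
  -- `σ = antiAffine u 0` is an anti-conformal affine involution of the plane preserving `Ω`
  have hnorm : ‖u‖ = 1 := by
    rcases hu with rfl | rfl | rfl | rfl <;> simp
  have hmaps : MapsTo (antiAffine u 0) R.carrier R.carrier := by
    intro z hz
    rw [← hΩ]
    exact ⟨z, hz, by rw [antiAffine_apply, add_zero]⟩
  -- symmetry principle: the modulus is `1/2`
  have hη : crossRatio x = 1 / 2 :=
    R.crossRatio_eq_half_of_antiAffine hnorm (by simp) hmaps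
      (by rw [antiAffine_apply, add_zero]; exact h0) (by rw [antiAffine_apply, add_zero]; exact h2)
      (by rw [antiAffine_apply, add_zero]; exact h1) hφx
  -- `I_a(1/2) = 1/2` and `bondDomainCrossingProb R δ → 1/2`
  rw [hη, sq_betaLaw_half ha]
  exact stub_symmetricHalf R u hu hΩ harcs

end Summit.CriticalPhenomena.CardyFormulaZ2.Cruxes.PolyominoGaussianLaw.Birth

end
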